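import Mathlib.NumberTheory.Padics.PadicIntegers
import Mathlib.RingTheory.Polynomial.UniqueFactorization
import Mathlib.RingTheory.Polynomial.Basic
import Mathlib.RingTheory.UniqueFactorizationDomain.Multiplicity
import Mathlib.RingTheory.Localization.FractionRing
import Mathlib.RingTheory.AlgebraicIndependent.Adjoin
import Mathlib.RingTheory.AlgebraicIndependent.TranscendenceBasis
import Mathlib.RingTheory.AlgebraicIndependent.AlgebraicClosure
import Mathlib.FieldTheory.IntermediateField.Adjoin.Algebra
import Mathlib.RingTheory.Norm.Basic
import HarnessLib

/-!
# A `p`-adic order on `ℚ_p(t_i)_{i ∈ ι}` (Gauss / multiplicity of `p` in `ℤ_p[t]`), proof-only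

Tools for the unconditional discharge of [pGC] Lem. 15.8 (slimness / center-freeness of `G_K` for
sub-`p`-adic `K`; cell file `RelativeGrothendieckConjecture.lean`, `pGC.Lem_15_8(_slim)`): the
slimness engine `isSlimGroup_absoluteGaloisGroup_of_isTorallyKummerFaithful` needs a homomorphism
`K^× → ℤ` not killing `p`.  Here: on the rational function field `ℚ_p(t_i)` there is a
homomorphism of its unit group to `ℤ` sending `p` to `1` (`exists_unitsHom_fractionRing_mvPolynomial`),
built from the multiplicity of the prime `p` of `ℤ_p[t_i]` after clearing `p`-power denominators.
No definitions (existence statements only); Mathlib-only. Classical (Gauss's lemma).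
[cite: MochizukiLocAn1999, Lem 15.8 p.80]
-/

noncomputable section

open scoped Classical
open MvPolynomial

namespace Literature.AnabelianGeometry.AbsoluteAnabelian

section Gauss

variable (p : ℕ) [Fact p.Prime] (ι : Type)

/-- Clearing denominators: every `f ∈ ℚ_p[t_i]` becomes `p`-integral after multiplication by a
power of `p`. [cite: MochizukiLocAn1999, Lem 15.8 p.80] -/
private theorem exists_pow_mul_eq_map (f : MvPolynomial ι ℚ_[p]) :
    ∃ (k : ℕ) (g : MvPolynomial ι ℤ_[p]),
      C ((p : ℚ_[p]) ^ k) * f = MvPolynomial.map (algebraMap ℤ_[p] ℚ_[p]) g := by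
  have hp : (p : ℕ).Prime := Fact.out
  have hp1 : (1 : ℝ) < p := by exact_mod_cast hp.one_lt
  -- a common exponent
  have hbd : ∀ x : ℚ_[p], ∃ k : ℕ, ‖(p : ℚ_[p]) ^ k * x‖ ≤ 1 := by
    intro x
    obtain ⟨k, hk⟩ := pow_unbounded_of_one_lt ‖x‖ hp1
    refine ⟨k, ?_⟩
    rw [norm_mul, norm_pow, Padic.norm_p, inv_pow, inv_mul_le_iff₀ (by positivity), mul_one]
    exact hk.le
  choose kx hkx using hbd
  let k : ℕ := f.support.sup fun m => kx (f.coeff m)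
  have hk : ∀ m ∈ f.support, ‖(p : ℚ_[p]) ^ k * f.coeff m‖ ≤ 1 := by
    intro m hm
    have hle : kx (f.coeff m) ≤ k := Finset.le_sup (f := fun m => kx (f.coeff m)) hm
    obtain ⟨j, hj⟩ := Nat.exists_eq_add_of_le hle
    rw [hj, pow_add, mul_comm ((p : ℚ_[p]) ^ _) _, mul_assoc, norm_mul, norm_pow, Padic.norm_p]
    calc ((p : ℝ)⁻¹) ^ j * ‖(p : ℚ_[p]) ^ kx (f.coeff m) * f.coeff m‖ ≤ 1 ^ j * 1 := by
          gcongr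
          · exact inv_le_one_of_one_le₀ hp1.le
          · exact hkx _
      _ = 1 := by simp
  -- integral coefficients
  let φ : ℚ_[p] → ℤ_[p] := fun x => if h : ‖(p : ℚ_[p]) ^ k * x‖ ≤ 1 then ⟨_, h⟩ else 0
  have hφ0 : φ 0 = 0 := by
    simp only [φ, mul_zero, norm_zero, zero_le_one, dif_pos]
    rfl
  let g : MvPolynomial ι ℤ_[p] := ∑ m ∈ f.support, monomial m (φ (f.coeff m))
  have hcoeff : ∀ m, g.coeff m = if m ∈ f.support then φ (f.coeff m) else 0 := by
    intro m
    simp only [g, coeff_sum, coeff_monomial]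
    rw [Finset.sum_ite_eq' f.support m (fun x => φ (f.coeff x))]
  refine ⟨k, g, ?_⟩
  ext m
  rw [coeff_C_mul, coeff_map, hcoeff]
  by_cases hm : m ∈ f.support
  · rw [if_pos hm]
    simp only [φ, dif_pos (hk m hm)]
    rfl
  · have h0 : f.coeff m = 0 := by simpa [MvPolynomial.mem_support_iff] using hm
    rw [if_neg hm, h0, mul_zero, map_zero]

/-- The `p`-ORDER on `ℚ_p[t_i] ∖ {0}`: there is a function `c` with `c(fg) = c(f) + c(g)` for
`f, g ≠ 0` and `c(p) = 1` (multiplicity of the prime `p ∈ ℤ_p[t_i]` after clearing denominators;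
Gauss's lemma is the primality of `p` in `ℤ_p[t_i]`). [cite: MochizukiLocAn1999, Lem 15.8 p.80] -/
theorem exists_padicOrder_mvPolynomial :
    ∃ c : MvPolynomial ι ℚ_[p] → ℤ,
      (∀ f g : MvPolynomial ι ℚ_[p], f ≠ 0 → g ≠ 0 → c (f * g) = c f + c g) ∧
      c (C (p : ℚ_[p])) = 1 := by
  have hp : (p : ℕ).Prime := Fact.out
  set π : MvPolynomial ι ℤ_[p] := C (p : ℤ_[p]) with hπ
  have hπprime : Prime π := (MvPolynomial.prime_C_iff (σ := ι)).mpr PadicInt.prime_p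
  have hinj : Function.Injective (MvPolynomial.map (σ := ι) (algebraMap ℤ_[p] ℚ_[p])) :=
    MvPolynomial.map_injective _ (IsFractionRing.injective ℤ_[p] ℚ_[p])
  have hmapπ : ∀ k : ℕ, MvPolynomial.map (algebraMap ℤ_[p] ℚ_[p]) (π ^ k) =
      C ((p : ℚ_[p]) ^ k) := by
    intro k
    rw [hπ, map_pow, map_C, ← C_pow]
    simp
  -- representations and their invariance
  have hwd : ∀ (f : MvPolynomial ι ℚ_[p]) (k k' : ℕ) (g g' : MvPolynomial ι ℤ_[p]), f ≠ 0 →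
      C ((p : ℚ_[p]) ^ k) * f = MvPolynomial.map (algebraMap ℤ_[p] ℚ_[p]) g →
      C ((p : ℚ_[p]) ^ k') * f = MvPolynomial.map (algebraMap ℤ_[p] ℚ_[p]) g' →
      (multiplicity π g : ℤ) - k = (multiplicity π g' : ℤ) - k' := by
    intro f k k' g g' hf hg hg'
    have hg0 : g ≠ 0 := by
      rintro rfl
      rw [map_zero, mul_eq_zero] at hg
      rcases hg with h | h
      · exact (pow_ne_zero k (by exact_mod_cast hp.ne_zero : (p : ℚ_[p]) ≠ 0)) (C_eq_zero.mp h)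
      · exact hf h
    have hg'0 : g' ≠ 0 := by
      rintro rfl
      rw [map_zero, mul_eq_zero] at hg'
      rcases hg' with h | h
      · exact (pow_ne_zero k' (by exact_mod_cast hp.ne_zero : (p : ℚ_[p]) ≠ 0)) (C_eq_zero.mp h)
      · exact hf h
    -- `π^k' g = π^k g'`
    have heq : π ^ k' * g = π ^ k * g' := by
      apply hinj
      rw [map_mul, map_mul, hmapπ, hmapπ, ← hg, ← hg', ← mul_assoc, ← mul_assoc, ← map_mul C,
        ← map_mul C, ← pow_add, ← pow_add, add_comm]
    have hfin : FiniteMultiplicity π (π ^ k' * g) :=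
      FiniteMultiplicity.of_prime_left hπprime (mul_ne_zero (pow_ne_zero _ hπprime.ne_zero) hg0)
    have hfin' : FiniteMultiplicity π (π ^ k * g') :=
      FiniteMultiplicity.of_prime_left hπprime (mul_ne_zero (pow_ne_zero _ hπprime.ne_zero) hg'0)
    have h1 := multiplicity_mul hπprime hfin
    have h2 := multiplicity_mul hπprime hfin'
    rw [multiplicity_pow_self_of_prime hπprime] at h1 h2
    rw [heq] at h1
    have : (k' : ℤ) + multiplicity π g = k + multiplicity π g' := by exact_mod_cast h1.symm.trans h2
    linarith
  -- the function
  choose kf gf hrep using exists_pow_mul_eq_map p ι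
  refine ⟨fun f => (multiplicity π (gf f) : ℤ) - kf f, ?_, ?_⟩
  · intro f g hf hg
    beta_reduce
    -- `(kf f + kf g, gf f * gf g)` represents `f * g`
    have hrep' : C ((p : ℚ_[p]) ^ (kf f + kf g)) * (f * g) =
        MvPolynomial.map (algebraMap ℤ_[p] ℚ_[p]) (gf f * gf g) := by
      rw [map_mul, ← hrep f, ← hrep g, pow_add, map_mul C]
      ring
    have hw := hwd (f * g) (kf (f * g)) (kf f + kf g) (gf (f * g)) (gf f * gf g)
      (mul_ne_zero hf hg) (hrep (f * g)) hrep'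
    have hgf : gf f ≠ 0 := by
      intro h
      have := hrep f
      rw [h, map_zero, mul_eq_zero] at this
      rcases this with h' | h'
      · exact (pow_ne_zero _ (by exact_mod_cast hp.ne_zero : (p : ℚ_[p]) ≠ 0)) (C_eq_zero.mp h')
      · exact hf h'
    have hgg : gf g ≠ 0 := by
      intro h
      have := hrep g
      rw [h, map_zero, mul_eq_zero] at this
      rcases this with h' | h'
      · exact (pow_ne_zero _ (by exact_mod_cast hp.ne_zero : (p : ℚ_[p]) ≠ 0)) (C_eq_zero.mp h')
      · exact hg h'
    have hfin : FiniteMultiplicity π (gf f * gf g) :=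
      FiniteMultiplicity.of_prime_left hπprime (mul_ne_zero hgf hgg)
    have hm := multiplicity_mul hπprime hfin
    rw [hw, hm]
    push_cast
    ring
  · -- `(0, π)` represents `C p`
    beta_reduce
    have hrep' : C ((p : ℚ_[p]) ^ 0) * C (p : ℚ_[p]) =
        MvPolynomial.map (algebraMap ℤ_[p] ℚ_[p]) π := by
      rw [pow_zero, C_1, one_mul, hπ, map_C]
      simp
    have hw := hwd (C (p : ℚ_[p])) (kf _) 0 (gf _) π
      (C_eq_zero.not.mpr (by exact_mod_cast hp.ne_zero)) (hrep _) hrep'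
    rw [hw, multiplicity_self]
    simp

/-- On the rational function field `ℚ_p(t_i) = Frac ℚ_p[t_i]` there is a homomorphism of the
unit group to `ℤ` taking the value `1` at `p` (the `p`-order of `exists_padicOrder_mvPolynomial`
extended to fractions). [cite: MochizukiLocAn1999, Lem 15.8 p.80] -/
theorem exists_unitsHom_fractionRing_mvPolynomial :
    ∃ u : (FractionRing (MvPolynomial ι ℚ_[p]))ˣ →* Multiplicative ℤ,
      ∀ z : (FractionRing (MvPolynomial ι ℚ_[p]))ˣ,
        (z : FractionRing (MvPolynomial ι ℚ_[p])) =
          algebraMap (MvPolynomial ι ℚ_[p]) _ (C (p : ℚ_[p])) → u z = Multiplicative.ofAdd 1 := by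
  have hp : (p : ℕ).Prime := Fact.out
  obtain ⟨c, hcmul, hcp⟩ := exists_padicOrder_mvPolynomial p ι
  have hc1 : c 1 = 0 := by
    have := hcmul 1 1 one_ne_zero one_ne_zero
    rw [one_mul] at this
    linarith
  -- representatives `z * s = a`
  have hsurj := fun z : FractionRing (MvPolynomial ι ℚ_[p]) =>
    IsLocalization.surj (nonZeroDivisors (MvPolynomial ι ℚ_[p])) z
  choose rep hrep using hsurj
  have hinj : Function.Injective
      (algebraMap (MvPolynomial ι ℚ_[p]) (FractionRing (MvPolynomial ι ℚ_[p]))) :=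
    IsFractionRing.injective _ _
  -- the value `c a - c s` does not depend on the representative
  have hval : ∀ (z : FractionRing (MvPolynomial ι ℚ_[p])) (a a' : MvPolynomial ι ℚ_[p])
      (s s' : nonZeroDivisors (MvPolynomial ι ℚ_[p])), z ≠ 0 →
      z * algebraMap _ _ (s : MvPolynomial ι ℚ_[p]) = algebraMap _ _ a →
      z * algebraMap _ _ (s' : MvPolynomial ι ℚ_[p]) = algebraMap _ _ a' →
      c a - c (s : MvPolynomial ι ℚ_[p]) = c a' - c (s' : MvPolynomial ι ℚ_[p]) := by
    intro z a a' s s' hz hs hs'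
    have hs0 : (s : MvPolynomial ι ℚ_[p]) ≠ 0 := nonZeroDivisors.ne_zero s.2
    have hs'0 : (s' : MvPolynomial ι ℚ_[p]) ≠ 0 := nonZeroDivisors.ne_zero s'.2
    have ha0 : a ≠ 0 := by
      rintro rfl
      rw [map_zero, mul_eq_zero] at hs
      rcases hs with h | h
      · exact hz h
      · exact hs0 (hinj (by rw [h, map_zero]))
    have ha'0 : a' ≠ 0 := by
      rintro rfl
      rw [map_zero, mul_eq_zero] at hs'
      rcases hs' with h | h
      · exact hz h
      · exact hs'0 (hinj (by rw [h, map_zero]))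
    have heq : a * s' = a' * s := by
      apply hinj
      rw [map_mul, map_mul, ← hs, ← hs']
      ring
    have := congrArg c heq
    rw [hcmul _ _ ha0 hs'0, hcmul _ _ ha'0 hs0] at this
    linarith
  refine ⟨{ toFun := fun z => Multiplicative.ofAdd
              (c (rep z.val).1 - c ((rep z.val).2 : MvPolynomial ι ℚ_[p]))
            map_one' := ?_
            map_mul' := ?_ }, ?_⟩
  · -- `1 = 1/1`
    have h := hval 1 _ 1 _ 1 one_ne_zero (hrep 1) (by simp)
    simp only [Units.val_one] at h ⊢
    rw [h, OneMemClass.coe_one, hc1, sub_zero]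
    rfl
  · intro z z'
    have hz : (z : FractionRing (MvPolynomial ι ℚ_[p])) ≠ 0 := z.ne_zero
    have hz' : (z' : FractionRing (MvPolynomial ι ℚ_[p])) ≠ 0 := z'.ne_zero
    -- the product of representatives represents the product
    have hprod : (z * z').val *
        algebraMap _ _ (((rep z.val).2 * (rep z'.val).2 : nonZeroDivisors (MvPolynomial ι ℚ_[p])) :
          MvPolynomial ι ℚ_[p]) = algebraMap _ _ ((rep z.val).1 * (rep z'.val).1) := by
      rw [Units.val_mul, Submonoid.coe_mul, map_mul, map_mul, ← hrep z.val, ← hrep z'.val]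
      ring
    have h := hval _ _ _ _ _ (mul_ne_zero hz hz') (hrep (z * z').val) hprod
    rw [← ofAdd_add, h, Submonoid.coe_mul,
      hcmul _ _ ?_ ?_, hcmul _ _ (nonZeroDivisors.ne_zero (rep z.val).2.2)
        (nonZeroDivisors.ne_zero (rep z'.val).2.2)]
    · congr 1
      ring
    · -- numerators are nonzero
      intro h0
      have := hrep z.val
      rw [h0, map_zero, mul_eq_zero] at this
      rcases this with h1 | h1
      · exact hz h1
      · exact nonZeroDivisors.ne_zero (rep z.val).2.2 (hinj (by rw [h1, map_zero]))
    · intro h0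
      have := hrep z'.val
      rw [h0, map_zero, mul_eq_zero] at this
      rcases this with h1 | h1
      · exact hz' h1
      · exact nonZeroDivisors.ne_zero (rep z'.val).2.2 (hinj (by rw [h1, map_zero]))
  · intro z hz
    have hz0 : (z : FractionRing (MvPolynomial ι ℚ_[p])) ≠ 0 := z.ne_zero
    have hrep' : (z : FractionRing (MvPolynomial ι ℚ_[p])) *
        algebraMap (MvPolynomial ι ℚ_[p]) (FractionRing (MvPolynomial ι ℚ_[p]))
          ((1 : nonZeroDivisors (MvPolynomial ι ℚ_[p])) : MvPolynomial ι ℚ_[p]) =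
        algebraMap (MvPolynomial ι ℚ_[p]) (FractionRing (MvPolynomial ι ℚ_[p])) (C (p : ℚ_[p])) := by
      rw [OneMemClass.coe_one, map_one, mul_one, hz]
    have h := hval _ _ _ _ _ hz0 (hrep z.val) hrep'
    change Multiplicative.ofAdd (c (rep z.val).1 - c ((rep z.val).2 : MvPolynomial ι ℚ_[p])) = _
    rw [h, OneMemClass.coe_one, hc1, hcp, sub_zero]


/-! ## Finitely generated extensions of `ℚ_p` -/

/-- Every finitely generated field extension `L` of `ℚ_p` admits a homomorphism `L^× → ℤ` that does
not vanish at `p` (transcendence basis `t`; the norm `N_{L/ℚ_p(t)}`; the `p`-order of `ℚ_p(t)`).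
[cite: MochizukiLocAn1999, Lem 15.8 p.80] -/
theorem exists_unitsHom_of_essFiniteType (L : Type) [Field L] [Algebra ℚ_[p] L]
    [Algebra.EssFiniteType ℚ_[p] L] :
    ∃ w : Lˣ →* Multiplicative ℤ, ∀ h0 : (p : L) ≠ 0, w (Units.mk0 (p : L) h0) ≠ 1 := by
  have hp : (p : ℕ).Prime := Fact.out
  -- a transcendence basis inside a finite generating set
  obtain ⟨s, hs⟩ := IntermediateField.fg_top ℚ_[p] L
  have halg : Algebra.IsAlgebraic (Algebra.adjoin ℚ_[p] (s : Set L)) L := by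
    rw [← IntermediateField.isAlgebraic_adjoin_iff_top, hs, Algebra.isAlgebraic_iff_isIntegral]
    exact Algebra.isIntegral_of_surjective IntermediateField.topEquiv.surjective
  obtain ⟨t, -, ht⟩ := exists_isTranscendenceBasis_subset (R := ℚ_[p]) (s : Set L)
  set F : IntermediateField ℚ_[p] L :=
    IntermediateField.adjoin ℚ_[p] (Set.range ((↑) : t → L)) with hF
  haveI : Algebra.EssFiniteType F L := Algebra.EssFiniteType.of_comp ℚ_[p] F L
  haveI : Algebra.IsAlgebraic F L := ht.isAlgebraic_field
  haveI : Module.Finite F L := Algebra.finite_of_essFiniteType_of_isAlgebraic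
  have hd : 0 < Module.finrank F L := Module.finrank_pos
  -- the `p`-order of `ℚ_p(t) ≅ F`
  obtain ⟨u, hu⟩ := exists_unitsHom_fractionRing_mvPolynomial p t
  set e : FractionRing (MvPolynomial t ℚ_[p]) ≃ₐ[ℚ_[p]] F := ht.1.aevalEquivField with he
  set eU : Fˣ →* (FractionRing (MvPolynomial t ℚ_[p]))ˣ :=
    Units.map ((e.symm : F ≃ₐ[ℚ_[p]] FractionRing (MvPolynomial t ℚ_[p])) :
      F →* FractionRing (MvPolynomial t ℚ_[p])) with heU
  set NU : Lˣ →* Fˣ := Units.map (Algebra.norm F : L →* F) with hNU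
  refine ⟨u.comp (eU.comp NU), fun h0 => ?_⟩
  -- the value at `p`
  have hpF : (algebraMap (MvPolynomial t ℚ_[p]) (FractionRing (MvPolynomial t ℚ_[p]))
      (C (p : ℚ_[p]))) ≠ 0 := by
    rw [map_ne_zero_iff _ (IsFractionRing.injective _ _)]
    exact C_eq_zero.not.mpr (by exact_mod_cast hp.ne_zero)
  set zp : (FractionRing (MvPolynomial t ℚ_[p]))ˣ := Units.mk0 _ hpF with hzp
  have hzpval : u zp = Multiplicative.ofAdd 1 := hu zp rfl
  have hkey : eU (NU (Units.mk0 (p : L) h0)) = zp ^ Module.finrank F L := by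
    apply Units.ext
    rw [Units.val_pow_eq_pow_val, hzp, Units.val_mk0, heU, Units.coe_map, hNU, Units.coe_map,
      Units.val_mk0, MonoidHom.coe_coe]
    change e.symm (Algebra.norm F (p : L)) = _
    have hpL : (p : L) = algebraMap F L (p : F) := by simp
    rw [hpL, Algebra.norm_algebraMap, map_pow]
    congr 1
    have : (p : F) = algebraMap ℚ_[p] F (p : ℚ_[p]) := by simp
    rw [this, AlgEquiv.commutes, IsScalarTower.algebraMap_apply ℚ_[p] (MvPolynomial t ℚ_[p])
      (FractionRing (MvPolynomial t ℚ_[p])), MvPolynomial.algebraMap_eq, map_natCast]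
  rw [MonoidHom.comp_apply, MonoidHom.comp_apply, hkey, map_pow, hzpval, ← ofAdd_nsmul,
    nsmul_eq_mul, mul_one]
  intro h
  have := congrArg Multiplicative.toAdd h
  simp only [toAdd_ofAdd, toAdd_one] at this
  exact hd.ne' (by exact_mod_cast this)

end Gauss

end Literature.AnabelianGeometry.AbsoluteAnabelian
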